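import Summits.AtomisticToContinuum.Crystallization.Theorems.FrustratedLawDichotomyStrainedPatchRecutLevelA

/-!
# LEVEL TRANSPORT: the fit predicate and the fit level under a near-identity linear recut
# (27623 strained-patch piece, T-side [CORE-FAR]; decomp-a2c lens-5 «RecutPairs», generation 54, step (R6)/(R7) — critic row 1000 (A3))

**FILE SPLIT (gate 400-line cap, hand-2 g27 landing edit; statements and proofs byte-identical):** this file = PART B (§4–§5) of lens-5 g54's `…RecutLevel` 1d8b923dcd1a6691; PART A (§1–§3: operator facts, `ShellGap`, `fitAtScale_recut`, `goodAtScale_recut`) is `…RecutLevelA` (imported; same namespace, so every fully-qualified name is unchanged and downstream `import …RecutLevel` sees both parts).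

(Imports `…RecutChart`.)  Census KAPPA-N♭ (j346805) measured the transport of the fit level under the affine recut `z₀ ↦ (1+A)·z₀`:
`|η(z₁) − η(z₀)| ≈ L_N·‖A‖`, `L_N = 2.13 ≈ 2(1+η)` — the `d`-pinned fit scale doubles the naive constant.  This module PROVES that mechanism:

* §1 operator facts for `1 + A` (`‖(1+A)u‖ ≤ (1+α)‖u‖`, `‖(1+A)u − u‖ ≤ ‖A‖‖u‖`, an inverse `1 + A'` with `‖A'‖ ≤ α/(1−α)`);
* §2 `ShellGap g y i`: the annulus of radii `(13/10 ∓ g)·nn_i(y)` about the site carries no site (the QUANTITATIVE form of the clean-gap clause of `GoodAt`;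
  a chart-side column, instrumentable per family member);
* §3 ★ `fitAtScale_recut` — ONE pattern branch: if `y` fits the pattern at tolerance `< η₀` (scale `d = nn_i`, `d ≤ 3/2`), has shell gap `g ≥ 3α`, and the sites of
  `y'` within `3` of `y' i'` are exactly the `(1+A)`-images of the sites of `y` within `3` of `y i` (`‖A‖ ≤ α ≤ 1/20`), then `y'` fits the same pattern at
  tolerance `< (η₀ + (2+η₀)α)/(1−α)` with any cap `≥ (1+α)d`: new scale `d' = nn_{i'}(y') ∈ [(1−α)d, (1+α)d]`, same isometry, pattern sites transported, misfit
  `≤ α(1+η)d + ηd + αd`, clean gap `γ' = (g(1−α) − (13/5)α)·d > 0`; ★ `goodAtScale_recut` (both branches);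
* §4 ★ `fitLevel_recut_le`: `fitLevel y' i' ≤ (f + (2+f)α)/(1−α)`, `f = fitLevel y i` (through the infimum), and ★★ `abs_fitLevel_recut_le`: with shell gaps on
  both sides, `|fitLevel y' i' − fitLevel y i| ≤ (2 + 2·max f f')·α/(1 − 2α)` (the inverse recut `1 + A'`);
* §5 PINNED to the recut of `…RecutChart`: for `RecutOf A z₀ c₀ z₁ c₁ e₀ e₁` with the centre kept, the `3`-neighbourhoods correspond under `1+A` (`recutOf_local`,
  `recutOf_local'`), hence ★★ `goodAtScale_recutOf` ((R7)′: the recut centre is `((η₀ + (2+η₀)α)/(1−α))`-good) and ★★★ `levelNear_of_recutOf` ((R6)♯ PROVED modulo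
  the shell-gap columns: `‖A‖ ≤ κL₀·t`, `0 ≤ t ≤ 1/60`, gaps `g ≥ 4κL₀t` on chart and recut, chart centre `η₀₀ = 1/16`-good, `(1+α)·nn ≤ (3/2)(1−α)` ⇒
  `LevelNear κN♯ t z₀ c₀ z₁ c₁` with `κN♯ = kN2 = 9/10`: `(2 + 2·0.077)·(2/5)/(1 − 2/150) ≤ 9/10`).
No sorry, no new axioms, no cite tokens, no instances / notation.  `--supports stmt-AtomisticToContinuum-27623`.
-/

noncomputable section

namespace Summit.AtomisticToContinuum.Crystallization.Theorems.FrustratedLawDichotomyStrainedPatchRecutLevel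

open scoped BigOperators Classical
open Summit.AtomisticToContinuum.Crystallization.Theorems.FrustratedLawDichotomyPeriodicBlockFlags (goodAtScale_mono)
open Summit.AtomisticToContinuum.Crystallization.Theorems.FrustratedLawDichotomyRangeCut (Sep)
open Summit.AtomisticToContinuum.Crystallization.Theorems.FrustratedLawDichotomyMotifLemmas
open Summit.AtomisticToContinuum.Crystallization.Theorems.FrustratedLawDichotomyAveragingCut
open Summit.AtomisticToContinuum.Crystallization.Theorems.FrustratedLawDichotomyAveragingRuleCap
open Summit.AtomisticToContinuum.Crystallization.Theorems.FrustratedLawDichotomyAveragingRuleTightFree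
open Summit.AtomisticToContinuum.Crystallization.Theorems.FrustratedLawDichotomyExemptDoor (SitePred)
open Summit.AtomisticToContinuum.Crystallization.Theorems.FrustratedLawDichotomyExemptAbsorption
open Summit.AtomisticToContinuum.Crystallization.Theorems.FrustratedLawDichotomyExemptAbsorptionRecord
open Summit.AtomisticToContinuum.Crystallization.Theorems.FrustratedLawDichotomyCollarCensus
open Summit.AtomisticToContinuum.Crystallization.Theorems.FrustratedLawDichotomyCollarCensusKappa
open Summit.AtomisticToContinuum.Crystallization.Theorems.FrustratedLawDichotomyStrainedPatchHomSplit
open Summit.AtomisticToContinuum.Crystallization.Theorems.FrustratedLawDichotomyStrainedPatchCleanCollar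
open Summit.AtomisticToContinuum.Crystallization.Theorems.FrustratedLawDichotomyStrainedPatchHomTube
open Summit.AtomisticToContinuum.Crystallization.Theorems.FrustratedLawDichotomyStrainedPatchHomIsometry
open Summit.AtomisticToContinuum.Crystallization.Theorems.FrustratedLawDichotomyStrainedPatchHomTubeIso
open Summit.AtomisticToContinuum.Crystallization.Theorems.FrustratedLawDichotomyStrainedPatchPhaseCut
open Summit.AtomisticToContinuum.Crystallization.Theorems.FrustratedLawDichotomyStrainedPatchCoreTube
open Summit.AtomisticToContinuum.Crystallization.Theorems.FrustratedLawDichotomyStrainedPatchCoreTubeRecord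
open Summit.AtomisticToContinuum.Crystallization.Theorems.FrustratedLawDichotomyStrainedPatchCoreTubeMilli
open Summit.AtomisticToContinuum.Crystallization.Theorems.FrustratedLawDichotomyStrainedPatchStrainBands
open Summit.AtomisticToContinuum.Crystallization.Theorems.FrustratedLawDichotomyStrainedPatchChartFamilies
open Summit.AtomisticToContinuum.Crystallization.Theorems.FrustratedLawDichotomyStrainedPatchChartFamiliesBent
open Summit.AtomisticToContinuum.Crystallization.Theorems.FrustratedLawDichotomyStrainedPatchChartFamiliesPinned
open Summit.AtomisticToContinuum.Crystallization.Theorems.FrustratedLawDichotomyStrainedPatchEnvelopeLaw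
open Summit.AtomisticToContinuum.Crystallization.Theorems.FrustratedLawDichotomyStrainedPatchEnvelopeTaylor
open Literature.Barriers.AtomisticToContinuum.FlatleyTheil2015 (fccVec)
open Summit.AtomisticToContinuum.Crystallization.Theorems.FrustratedLawDichotomyStrainedPatchRecutPairs
open Summit.AtomisticToContinuum.Crystallization.Theorems.FrustratedLawDichotomyStrainedPatchRecutKinematics
open Literature.Barriers.AtomisticToContinuum.FlatleyTheil2015 (fccPoint)
open Summit.AtomisticToContinuum.Crystallization.Theorems.FrustratedLawDichotomyStrainedPatchHomRelief (latPt_fccVec_eq)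
open Summit.AtomisticToContinuum.Crystallization.Theorems.FrustratedLawDichotomyStrainedPatchHomLatticeBox (norm_apply_ge_of_near_one latPt_zero
  mem_box_of_norm_fccPoint_lt)
open Summit.AtomisticToContinuum.Crystallization.Theorems.FrustratedLawDichotomyStrainedPatchHomLatticeBoxHcp (latPt_eq_apply_one shifted_eq_apply)
open Summit.AtomisticToContinuum.Crystallization.Theorems.FrustratedLawDichotomyStrainedPatchHomLatticeBoxWindow (mem_box_of_norm_hexPt_lt'
  mem_box_of_norm_hexPt_add_shift_lt')
open Summit.AtomisticToContinuum.Crystallization.Theorems.FrustratedLawDichotomyStrainedPatchWindowFamilies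
open Summit.AtomisticToContinuum.Crystallization.Theorems.FrustratedLawDichotomyStrainedPatchRecutBuild
open Summit.AtomisticToContinuum.Crystallization.Theorems.FrustratedLawDichotomyStrainedPatchRecutRecord
open Summit.AtomisticToContinuum.Crystallization.Theorems.FrustratedLawDichotomyStrainedPatchRecutChart
open Literature.Geometry.DiscreteGeometry (nearestDist nearestDist_le_dist le_nearestDist exists_nearestDist_eq_dist nearestDist_nonneg
  fccKissingPattern hcpKissingPattern card_fccKissingPattern card_hcpKissingPattern norm_eq_one_of_mem_fccKissingPattern norm_eq_one_of_mem_hcpKissingPattern)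

/-! ## §4. ★ The fit level under the recut -/

/-- ★ **ONE-SIDED LEVEL TRANSPORT** — `fitLevel y' i' ≤ (f + (2+f)·α)/(1−α)`, `f = fitLevel y i` (cap `3/2` kept: `(1+α)·nn_i(y) ≤ 3/2`). [folklore] -/
theorem fitLevel_recut_le {N N' : ℕ} {y : Fin N → E3} {i : Fin N} {y' : Fin N' → E3} {i' : Fin N'} (hy : Function.Injective y)
    (hy' : Function.Injective y') (A : E3 →L[ℝ] E3) {α g : ℝ} (hA : ‖A‖ ≤ α) (hα : α ≤ 1 / 20) (hg : 3 * α ≤ g) (hg0 : 0 < g) (hg1 : g ≤ 1 / 10)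
    (H1 : ∀ k', dist (y' k') (y' i') ≤ 3 → ∃ k, y' k' - y' i' = ((1 : E3 →L[ℝ] E3) + A) (y k - y i))
    (H2 : ∀ k, dist (y k) (y i) ≤ 3 → ∃ k', y' k' - y' i' = ((1 : E3 →L[ℝ] E3) + A) (y k - y i))
    (HG : ShellGap g y i) (hD : (1 + α) * nearestDist y i ≤ 3 / 2) (hex : ∃ η, η ≤ 3 / 4 ∧ GoodAtScale η (3 / 2) y i) :
    fitLevel y' i' ≤ (fitLevel y i + (2 + fitLevel y i) * α) / (1 - α) := by
  obtain ⟨η₁, hη₁, hg₁⟩ := hex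
  have hα0 : 0 ≤ α := (norm_nonneg A).trans hA
  have h1α : 0 < 1 - α := by linarith
  have hS : {η : ℝ | GoodAtScale η (3 / 2) y i}.Nonempty := ⟨η₁, hg₁⟩
  have hf : fitLevel y i ≤ η₁ := fitLevel_le_of_goodAtScale hg₁
  have hd : nearestDist y i ≤ 3 / 2 := by nlinarith [nearestDist_nonneg y i]
  refine le_of_forall_pos_le_add fun ε hε => ?_
  have hδ : 0 < min (ε / 2) (1 / 4) := lt_min (by linarith) (by norm_num)
  obtain ⟨η₂, hη₂S, hη₂lt⟩ := exists_lt_of_csInf_lt hS (lt_add_of_pos_right (fitLevel y i) hδ)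
  have hδ1 := min_le_right (ε / 2) (1 / 4)
  have hδ2 := min_le_left (ε / 2) (1 / 4)
  have hη₂1 : η₂ ≤ 1 := by linarith
  have hgood := goodAtScale_recut hy hy' A hA hα hg hg0 hg1 H1 H2 HG hd hη₂1 hD hη₂S
  have hle : η₂ + (2 + η₂) * α ≤ fitLevel y i + (2 + fitLevel y i) * α + ε * (1 - α) := by nlinarith
  calc fitLevel y' i' ≤ (η₂ + (2 + η₂) * α) / (1 - α) := fitLevel_le_of_goodAtScale hgood
    _ ≤ (fitLevel y i + (2 + fitLevel y i) * α + ε * (1 - α)) / (1 - α) := div_le_div_of_nonneg_right hle h1α.le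
    _ = (fitLevel y i + (2 + fitLevel y i) * α) / (1 - α) + ε := by rw [add_div, mul_div_assoc, div_self h1α.ne', mul_one]

/-- Arithmetic of the one-sided bound: `f ≤ (f' + (2+f')a)/(1−a)` gives `f − f' ≤ (2+2f')a/(1−a)`. [formal bookkeeping] -/
theorem sub_le_of_level_bound {f f' a : ℝ} (ha : a < 1) (h : f ≤ (f' + (2 + f') * a) / (1 - a)) : f - f' ≤ (2 + 2 * f') * a / (1 - a) := by
  have hpos : 0 < 1 - a := by linarith
  rw [le_div_iff₀ hpos] at h
  rw [le_div_iff₀ hpos]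
  nlinarith

/-- ★★ **TWO-SIDED LEVEL TRANSPORT** — with shell gaps `g ≥ 4α` on both sides, `‖A‖ ≤ α ≤ 1/25`, the cap condition `(1+α)·nn_i(y) ≤ (3/2)(1−α)` and a
`1/8`-good site: `|fitLevel y' i' − fitLevel y i| ≤ (2 + 2·max f f')·α/(1 − 2α)` (the reverse direction through the inverse recut `1 + A'`,
`‖A'‖ ≤ α/(1−α)`).  This is census KAPPA-N♭'s transport constant `L_N ≈ 2(1+η)`. [folklore] -/
theorem abs_fitLevel_recut_le {N N' : ℕ} {y : Fin N → E3} {i : Fin N} {y' : Fin N' → E3} {i' : Fin N'} (hy : Function.Injective y)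
    (hy' : Function.Injective y') (A : E3 →L[ℝ] E3) {α g : ℝ} (hA : ‖A‖ ≤ α) (hα : α ≤ 1 / 25) (hg : 4 * α ≤ g) (hg0 : 0 < g) (hg1 : g ≤ 1 / 10)
    (H1 : ∀ k', dist (y' k') (y' i') ≤ 3 → ∃ k, y' k' - y' i' = ((1 : E3 →L[ℝ] E3) + A) (y k - y i))
    (H2 : ∀ k, dist (y k) (y i) ≤ 3 → ∃ k', y' k' - y' i' = ((1 : E3 →L[ℝ] E3) + A) (y k - y i))
    (HG : ShellGap g y i) (HG' : ShellGap g y' i') (hd : (1 + α) * nearestDist y i ≤ 3 / 2 * (1 - α)) (h8 : GoodAtScale (1 / 8) (3 / 2) y i) :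
    |fitLevel y' i' - fitLevel y i| ≤ (2 + 2 * max (fitLevel y i) (fitLevel y' i')) * α / (1 - 2 * α) := by
  have hα0 : 0 ≤ α := (norm_nonneg A).trans hA
  have h1α : 0 < 1 - α := by linarith
  have h2α : 0 < 1 - 2 * α := by linarith
  have hnn := nearestDist_nonneg y i
  have hα' : α ≤ 1 / 20 := by linarith
  have hg3 : 3 * α ≤ g := by linarith
  have hD : (1 + α) * nearestDist y i ≤ 3 / 2 := by nlinarith
  have hd3 : nearestDist y i ≤ 3 := by nlinarith
  have hex : ∃ k, k ≠ i := exists_ne_of_goodAtScale h8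
  have hf0 : 0 ≤ fitLevel y i := le_csInf ⟨_, h8⟩ fun η hη => (goodAtScale_pos hη).le
  have hmax1 := le_max_left (fitLevel y i) (fitLevel y' i')
  have hmax2 := le_max_right (fitLevel y i) (fitLevel y' i')
  -- forward
  have hfw := fitLevel_recut_le hy hy' A hA hα' hg3 hg0 hg1 H1 H2 HG hD ⟨1 / 8, by norm_num, h8⟩
  -- the recut is good at `(1/8 + (17/8)α)/(1−α) ≤ 3/4`
  have hgood' := goodAtScale_recut hy hy' A hA hα' hg3 hg0 hg1 H1 H2 HG (by nlinarith) (by norm_num : (1 / 8 : ℝ) ≤ 1) hD h8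
  have hη' : (1 / 8 + (2 + 1 / 8) * α) / (1 - α) ≤ 3 / 4 := by rw [div_le_iff₀ h1α]; nlinarith
  have hf'0 : 0 ≤ fitLevel y' i' := le_csInf ⟨_, hgood'⟩ fun η hη => (goodAtScale_pos hη).le
  -- reverse, through the inverse recut
  obtain ⟨A', hA', hinv1, hinv2⟩ := exists_inv_one_add A hA (by linarith)
  have hα'1 : α / (1 - α) ≤ 1 / 20 := by rw [div_le_iff₀ h1α]; nlinarith
  have hg3' : 3 * (α / (1 - α)) ≤ g := by rw [mul_div_assoc', div_le_iff₀ h1α]; nlinarith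
  have H1' : ∀ k, dist (y k) (y i) ≤ 3 → ∃ k', y k - y i = ((1 : E3 →L[ℝ] E3) + A') (y' k' - y' i') := fun k hk => by
    obtain ⟨k', hk'⟩ := H2 k hk; exact ⟨k', by rw [hk', hinv1]⟩
  have H2' : ∀ k', dist (y' k') (y' i') ≤ 3 → ∃ k, y k - y i = ((1 : E3 →L[ℝ] E3) + A') (y' k' - y' i') := fun k' hk' => by
    obtain ⟨k, hk⟩ := H1 k' hk'; exact ⟨k, by rw [hk, hinv1]⟩
  have hd'le := nearestDist_recut_le hy A hA (by linarith) H2 hex hd3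
  have hD'' : (1 + α / (1 - α)) * nearestDist y' i' ≤ 3 / 2 := by
    have h1 : (1 + α / (1 - α)) = 1 / (1 - α) := by
      field_simp
      ring
    rw [h1, div_mul_eq_mul_div, one_mul, div_le_iff₀ h1α]; nlinarith
  have hbw := fitLevel_recut_le hy' hy A' hA' hα'1 hg3' hg0 hg1 H1' H2' HG' hD'' ⟨_, hη', hgood'⟩
  -- the two one-sided bounds in the common form
  have hq : α / (1 - α) / (1 - α / (1 - α)) = α / (1 - 2 * α) := by
    have h1 : 1 - α / (1 - α) = (1 - 2 * α) / (1 - α) := by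
      field_simp
      ring
    rw [h1, div_div_div_cancel_right₀ h1α.ne']
  rw [abs_sub_le_iff]
  constructor
  · -- f' − f ≤ (2+2f)α/(1−α) ≤ (2 + 2 max)α/(1−2α)
    refine (sub_le_of_level_bound (by linarith) hfw).trans ?_
    rw [div_le_div_iff₀ h1α h2α]
    nlinarith [mul_nonneg hα0 hf0, mul_nonneg hα0 (sub_nonneg.2 hmax1)]
  · -- f − f' ≤ (2+2f')α'/(1−α') = (2+2f')α/(1−2α) ≤ (2 + 2 max)α/(1−2α)
    have hα'lt : α / (1 - α) < 1 := by linarith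
    refine (sub_le_of_level_bound hα'lt hbw).trans ?_
    rw [mul_div_assoc, hq, ← mul_div_assoc, div_le_div_iff_of_pos_right h2α]
    nlinarith [mul_nonneg hα0 hf'0, mul_nonneg hα0 (sub_nonneg.2 hmax2)]

/-! ## §5. Pinned to the recut of `…RecutChart`: (R7)′ and (R6)♯ -/

/-- ★ **THE RECUT IS LOCALLY THE `(1+A)`-IMAGE OF THE CHART** — for `RecutOf A z₀ c₀ z₁ c₁ e₀ e₁` (`‖A‖ ≤ 1/150`): every recut site within `3` of the centre
is `z₁ c₁ + (1+A)(z₀ k − z₀ c₀)` for a chart site `k`, and every chart site within `3` of `z₀ c₀` has such an image (window book-keeping: bent norm `≤ 3` ⇒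
skeleton norm `≤ 5.2 ≤ 133/10` on both sides). [folklore] -/
theorem recutOf_local {A : E3 →L[ℝ] E3} {M₀ : ℕ} {z₀ : Fin M₀ → E3} {c₀ : Fin M₀} {M₁ : ℕ} {z₁ : Fin M₁ → E3} {c₁ : Fin M₁} {M : ℕ}
    {e₀ : Fin M → Fin M₀} {e₁ : Fin M → Fin M₁} (h : RecutOf A z₀ c₀ z₁ c₁ e₀ e₁) (hA : ‖A‖ ≤ 1 / 150) :
    (∀ k', dist (z₁ k') (z₁ c₁) ≤ 3 → ∃ k, z₁ k' - z₁ c₁ = ((1 : E3 →L[ℝ] E3) + A) (z₀ k - z₀ c₀)) ∧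
      ∀ k, dist (z₀ k) (z₀ c₀) ≤ 3 → ∃ k', z₁ k' - z₁ c₁ = ((1 : E3 →L[ℝ] E3) + A) (z₀ k - z₀ c₀) := by
  obtain ⟨φ, b₀, b₁, G, ξ, s, w, hb₀, hb₁, hs, hzs, hconj, -, hwr, -, hz₁, -⟩ := h
  have hσ : ∀ k, s k - s c₀ ∈ latSet φ G ξ ∧ ‖s k - s c₀‖ ≤ 133 / 10 := by
    intro k
    have hk : s k ∈ homRange φ G ξ (133 / 10) (s c₀) := hs ▸ ⟨k, rfl⟩
    rw [mem_homRange_iff, dist_eq_norm] at hk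
    exact ⟨hk.2, hk.1⟩
  have hdiff₁ : ∀ j, z₁ j - z₁ c₁ = b₁ (w j) := fun j => by rw [hz₁ j, add_sub_cancel_left]
  refine ⟨fun k' hk' => ?_, fun k hk => ?_⟩
  · have hwj : w k' ∈ Set.range w := ⟨k', rfl⟩
    rw [hwr] at hwj
    obtain ⟨hlat, hnorm⟩ := hwj
    rw [latSet_mul] at hlat
    obtain ⟨u, hu, huj⟩ := hlat
    have hu27 : ‖u‖ ≤ 27 / 2 := norm_le_window A hA (by rw [huj]; exact hnorm)
    have hd : dist (z₁ k') (z₁ c₁) = ‖((1 : E3 →L[ℝ] E3) + A) (b₀ u)‖ := by rw [dist_eq_norm, hdiff₁, ← huj, hconj]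
    rw [hd] at hk'
    have hal := antilipschitz_one_add A hA (b₀ u)
    have hbu : ‖b₀ u‖ ≤ 111 / 20 := by nlinarith
    have hu13 : ‖u‖ ≤ 133 / 10 := by have h := norm_le_of_bends0_window' hb₀ hu27; linarith
    have hsu : s c₀ + u ∈ Set.range s := by
      rw [hs, mem_homRange_iff, dist_eq_norm, add_sub_cancel_left]
      exact ⟨hu13, hu⟩
    obtain ⟨k, hk⟩ := hsu
    have hσk : s k - s c₀ = u := by rw [hk, add_sub_cancel_left]
    exact ⟨k, by rw [hdiff₁, ← huj, hconj, hzs, hσk]⟩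
  · have hb : ‖b₀ (s k - s c₀)‖ ≤ 3 := by rw [← hzs, ← dist_eq_norm]; exact hk
    have hmem : ((1 : E3 →L[ℝ] E3) + A) (s k - s c₀) ∈ Set.range w := by
      rw [hwr]
      refine ⟨?_, ?_⟩
      · rw [latSet_mul]; exact ⟨s k - s c₀, (hσ k).1, rfl⟩
      · have hb' := norm_le_of_bends0_window hb₀ (hσ k).2
        have h1 := norm_one_add_apply_le A hA (s k - s c₀)
        nlinarith
    obtain ⟨k', hk'⟩ := hmem
    exact ⟨k', by rw [hdiff₁, hk', hconj, hzs]⟩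

/-- ★★ **(R7)′ THE RECUT CENTRE IS GOOD, QUANTITATIVELY** — chart centre `η₀`-good (cap `3/2`), shell gap `g ∈ [3α, 1/10]`, `‖A‖ ≤ α ≤ 1/150`,
`(1+α)·nn ≤ 3/2` ⇒ the recut centre is `((η₀ + (2+η₀)α)/(1−α))`-good at cap `3/2`.  At the pins (`η₀ ≤ η₀₀ = 1/16`, `α ≤ κL₀t ≤ 1/150`) the level is `≤ 0.0768`;
the (RFᴿ) clause `GoodAtScale η₃₀ (3/2) z₁ c₁` (`η₃₀ = 7/100`) therefore holds whenever `η₀ + (2+η₀)α < (7/100)(1−α)` (e.g. `η(z₀) ≤ 0.0593` at `T₀max`) —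
the (R7) GOOD-WINDOW flag of NODE-g54 §14, now a formula. [folklore] -/
theorem goodAtScale_recutOf {A : E3 →L[ℝ] E3} {M₀ : ℕ} {z₀ : Fin M₀ → E3} {c₀ : Fin M₀} {M₁ : ℕ} {z₁ : Fin M₁ → E3} {c₁ : Fin M₁} {M : ℕ}
    {e₀ : Fin M → Fin M₀} {e₁ : Fin M → Fin M₁} (h : RecutOf A z₀ c₀ z₁ c₁ e₀ e₁) {α g : ℝ} (hA : ‖A‖ ≤ α) (hα : α ≤ 1 / 150) (hg : 3 * α ≤ g)
    (hg0 : 0 < g) (hg1 : g ≤ 1 / 10) (hinj₀ : Function.Injective z₀) (hinj₁ : Function.Injective z₁) (HG : ShellGap g z₀ c₀)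
    (hd : (1 + α) * nearestDist z₀ c₀ ≤ 3 / 2) {η₀ : ℝ} (hη₀ : η₀ ≤ 1) (h0 : GoodAtScale η₀ (3 / 2) z₀ c₀) :
    GoodAtScale ((η₀ + (2 + η₀) * α) / (1 - α)) (3 / 2) z₁ c₁ := by
  have hα0 : 0 ≤ α := (norm_nonneg A).trans hA
  obtain ⟨H1, H2⟩ := recutOf_local h (hA.trans hα)
  exact goodAtScale_recut hinj₀ hinj₁ A hA (hα.trans (by norm_num)) hg hg0 hg1 H1 H2 HG (by nlinarith [nearestDist_nonneg z₀ c₀]) hη₀ hd h0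

/-- ★★★ **(R6)♯ LEVEL-NEARNESS OF THE RECUT AT `κN♯ = 9/10`, PROVED MODULO THE SHELL-GAP COLUMNS** — for a recut `RecutOf A z₀ c₀ z₁ c₁ e₀ e₁` with
`‖A‖ ≤ κL₀·max t 0`, `0 ≤ t ≤ 1/60`, both injective, shell gaps `g ≥ 4κL₀t` (`g ≤ 1/10`) at the chart centre AND at the recut centre, the cap condition
`(1 + κL₀t)·nn(z₀,c₀) ≤ (3/2)(1 − κL₀t)` and an `η₀₀ = 1/16`-good chart centre: `LevelNear κN♯ t z₀ c₀ z₁ c₁`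
(`|η(z₁) − η(z₀)| ≤ (2 + 2·(1/10))·(2/5)t/(1 − (4/5)t) ≤ (9/10)·t`).  The (R6) clause of (LSᴿ♯-bentW) is thereby reduced to the instrument columns SHELLGAP. [folklore] -/
theorem levelNear_of_recutOf {A : E3 →L[ℝ] E3} {M₀ : ℕ} {z₀ : Fin M₀ → E3} {c₀ : Fin M₀} {M₁ : ℕ} {z₁ : Fin M₁ → E3} {c₁ : Fin M₁} {M : ℕ}
    {e₀ : Fin M → Fin M₀} {e₁ : Fin M → Fin M₁} (h : RecutOf A z₀ c₀ z₁ c₁ e₀ e₁) {t g : ℝ} (hA : ‖A‖ ≤ kL0 * max t 0) (ht : 0 ≤ t) (ht60 : t ≤ 1 / 60)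
    (hinj₀ : Function.Injective z₀) (hinj₁ : Function.Injective z₁) (HG₀ : ShellGap g z₀ c₀) (HG₁ : ShellGap g z₁ c₁) (hg : 4 * (kL0 * t) ≤ g)
    (hg0 : 0 < g) (hg1 : g ≤ 1 / 10) (hd : (1 + kL0 * t) * nearestDist z₀ c₀ ≤ 3 / 2 * (1 - kL0 * t)) (h16 : GoodAtScale (1 / 16) (3 / 2) z₀ c₀) :
    LevelNear kN2 t z₀ c₀ z₁ c₁ := by
  have hmax : max t 0 = t := max_eq_left ht
  rw [hmax] at hA
  have hkl : kL0 * t = 2 / 5 * t := by rw [kL0]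
  have hα150 : kL0 * t ≤ 1 / 150 := by rw [hkl]; linarith
  have hα25 : kL0 * t ≤ 1 / 25 := by linarith
  have hα0 : 0 ≤ kL0 * t := by rw [hkl]; positivity
  have hnn := nearestDist_nonneg z₀ c₀
  obtain ⟨H1, H2⟩ := recutOf_local h (hA.trans hα150)
  have h8 : GoodAtScale (1 / 8) (3 / 2) z₀ c₀ := goodAtScale_mono (by norm_num) h16
  have habs := abs_fitLevel_recut_le hinj₀ hinj₁ A hA hα25 hg hg0 hg1 H1 H2 HG₀ HG₁ hd h8
  -- the two levels are small: `f₀ ≤ 1/16`, `f₁ ≤ (1/16 + (33/16)α)/(1−α) ≤ 1/10`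
  have hf₀ : fitLevel z₀ c₀ ≤ 1 / 16 := fitLevel_le_of_goodAtScale h16
  have hD : (1 + kL0 * t) * nearestDist z₀ c₀ ≤ 3 / 2 := by nlinarith
  have hg3 : 3 * (kL0 * t) ≤ g := by linarith
  have hf₁ : fitLevel z₁ c₁ ≤ 1 / 10 := by
    have h1 := fitLevel_le_of_goodAtScale (goodAtScale_recut hinj₀ hinj₁ A hA (by linarith) hg3 hg0 hg1 H1 H2 HG₀ (by nlinarith)
      (by norm_num : (1 / 16 : ℝ) ≤ 1) hD h16)
    refine h1.trans ?_
    rw [div_le_iff₀ (by linarith)]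
    nlinarith
  have hM : max (fitLevel z₀ c₀) (fitLevel z₁ c₁) ≤ 1 / 10 := max_le (by linarith) hf₁
  show |fitLevel z₁ c₁ - fitLevel z₀ c₀| ≤ kN2 * max t 0
  rw [hmax, kN2]
  refine habs.trans ?_
  rw [div_le_iff₀ (by linarith), hkl]
  nlinarith [mul_nonneg ht (sub_nonneg.2 ht60), mul_nonneg ht (sub_nonneg.2 hM)]

end Summit.AtomisticToContinuum.Crystallization.Theorems.FrustratedLawDichotomyStrainedPatchRecutLevel
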